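/-
Copyright (c) 2026 the pub-hodgecm-mathlib formalisation cell (harness21).  Prover seat hodgecm-mathlib-K2Liu-p01 (g3): Track B «K2-LIT»,
#184♮ = hLiu418 = stmt-HodgeConjecture-24832; organ file 2∕4 for socket #30a `sig_K2LiuThetaTypeSphericalEigenvaluesSplit` at a GENERAL
enumeration `e₁` (LEAD F0P6-plan (g10) RULINGS 2026-09-04T01:20:48Z (a) and 01:30:25Z «road change =, #30aT withdrawn»); 2026-09-04.
-/
import Summits.HodgeConjecture.HodgeConjecture.Theorems.K2LiuSplitPlaceHeckeLocalEnum
import HarnessLib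

/-!
# Crux `HLiu418`, Track B road `K2_Liu`, unit U5c: the split-place JUNCTION at an ARBITRARY enumeration `e : Fin 2 × Fin 1 ≃ Fin 2`
# (the `e`-general twins of ★ `cm_hloc_one∕two`: S4c-L-at-`e` IS S4c-G's `hloc` at the CM package)

Cell `hodgecm-mathlib`, crux item hLiu418 = `stmt-HodgeConjecture-24832`; LEAD F0P6-plan (g10), planner K2Liu-plan (g2), prover K2Liu-p01 (g3).
THEOREMS ONLY (no `def`, no instance, no notation, no named-fact hypothesis, no `sorry`); lane `--supports stmt-HodgeConjecture-24832`
(count-neutral helper).  Heart-beat caps (LEAD instrument 01:30:25Z: per-declaration, measured, ≤ 2 000 000 with the figure in the comment):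
the two declarations below are ONE definitional re-spelling of the θ-package tower each, exactly as their ★ twins `cm_hloc_one` (1.49 M) and
`cm_hloc_two` (1.27 M): measured here 1 200 000 fails ∕ 1 600 000 passes, so both carry `maxHeartbeats 1600000`.

* **`cm_hloc_one_enum`**, **`cm_hloc_two_enum`** — for ANY enumeration `e : Fin 2 × Fin 1 ≃ Fin 2` and ANY line parameter `a : (L⁺)ˣ`, at THE CM
  `θ`-package `cmFinLocalFamily L e dJ …` of the line `⟨a⟩`: the `e`-general S4c-L eigen-equations (★
  `K2LiuSplitPlaceHeckeLocalEnum.splitPlace_heckeOperator_localInt_apply_localSplittingCM_comp_localLineInl_enum`) ARE the `hloc` hypothesis of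
  S4c-G (★ `rhoVAtLine_congr_heckeTAt_apply_eq_smul`, generic in `e₁`) at `ϖ := ϖ_w`, `i = 1, 2` — statements = ★ `cm_hloc_one∕two` with
  `finProdFinEquiv ↦ e`, `r.toFun ε ↦ a`; proofs = one application each (★ `gram_realDiagonal_TW L e`, ★ `congrW_undoubledSplittings_cmFinLocalFamily_s L e`,
  the `e`-general big-form lemmas of the prequel).

HONEST LABEL.  Count-neutral organ toward socket #30a (general `e₁`); retires nothing by itself: `HC_CM` is proved only modulo the 7 printed
citations (2 remaining named inputs: hLiu418 = `stmt-HodgeConjecture-24832`, h413 = `stmt-HodgeConjecture-24833`) until rung 0 closes.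

## References
* [Liu2021] Y. Liu, *Fourier–Jacobi cycles and arithmetic relative trace formula*, Camb. J. Math. 9 (2021): App. D, proof of Lem. D.1 (first
  paragraph, l. 5241, p. 126).
* [GelbartRogawski1991] S. Gelbart, J. Rogawski, Invent. Math. 105 (1991): §3.2 p. 457.
-/

set_option autoImplicit false

noncomputable section

open scoped Matrix Kronecker TensorProduct Classical RestrictedProduct MatrixGroups NumberField
open NumberField NumberField.InfinitePlace IsDedekindDomain Filter Set MulAction Matrix
open _root_.MeasureTheory
open ValuativeRel
open Literature.RepresentationTheory (TwistedCoinv.rep TwistedCoinv.Coinv TwistedCoinv.mk)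
open Literature.RepresentationTheory.HeisenbergGroup (MpPsi)
open Literature.NumberTheory.Automorphic.Zelevinsky1980 (lastBlockLabel)
open Literature.NumberTheory Literature.NumberTheory.Automorphic Literature.NumberTheory.Automorphic.UnitaryGroup
open Literature.NumberTheory.GelbartRogawski1991 Literature.NumberTheory.GelbartRogawski1991.UnitaryDualPair
open Literature.NumberTheory.GelbartRogawski1991.UnitaryDualPair.WeilCoinv
open Literature.NumberTheory.GelbartRogawski1991.UnitaryDualPair.LocalSplitting
open Literature.NumberTheory.GelbartRogawski1991.GRConstruction
open Literature.NumberTheory.Weil1964 Literature.RepresentationTheory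
open Literature.NumberTheory.GaloisRepresentations Literature.RepresentationTheory.HarrisKudlaSweet1996
open Literature.NumberTheory.Automorphic.Liu2021 Literature.NumberTheory.Automorphic.Liu2021.Def411WeilCarriersDoubling
open Literature.NumberTheory.Automorphic.Liu2021.Def411WeilCarriers
open Literature.NumberTheory.Automorphic.IdeleClassGroup Literature.RepresentationTheory.Liu2021

namespace Summit.HodgeConjecture.HodgeConjecture.Cruxes.HLiu418.K2LiuSplitPlaceHeckeJunctionEnum

open K2LiuSplitPlaceHeckeLocalEnum

/-! ## §3  The junction at an arbitrary enumeration: the `e`-general S4c-L IS S4c-G's `hloc` at the CM package -/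

set_option maxHeartbeats 1600000 in -- measured 2026-09-04 (K2Liu-p01 g3): 1 200 000 FAILS (isDefEq), 1 600 000 passes; ★ twin `cm_hloc_one` 1.49 M by import — one definitional re-spelling of the θ-package tower
/-- **Junction at an ARBITRARY enumeration `e : Fin 2 × Fin 1 ≃ Fin 2`, `T₁`** (★ `cm_hloc_one` is the case `e = finProdFinEquiv`,
`a = r.toFun ε`): at THE CM `θ`-package `cmFinLocalFamily L e dJ …` of the line `⟨a⟩`, the `e`-general S4c-L eigen-equation IS the `hloc`
hypothesis of S4c-G (★ `rhoVAtLine_congr_heckeTAt_apply_eq_smul`, generic in `e₁`) at `ϖ := ϖ_w`, `i = 1`, in S4c-G's carrier form.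
[cite: Liu2021, App. D proof of Lemma D.1, first paragraph (l. 5241, p. 126)] [cite: GelbartRogawski1991, §3.2 p. 457] -/
theorem cm_hloc_one_enum (L : Type) [Field L] [NumberField L] [IsCMField L]
    (θ : HeckeCharacter L) (hθu : θ.IsUnitary) (hθs : IsSplittingChar L 1 θ)
    (dJ : Fin 2 → L) (hdJ : ∀ i, IsCMField.complexConj L (dJ i) = dJ i) (hdJ0 : ∀ i, dJ i ≠ 0)
    (e : Fin 2 × Fin 1 ≃ Fin 2) (a : (↥(maximalRealSubfield L))ˣ)
    (χ : Chi ↥(maximalRealSubfield L) L (IsCMField.complexConj L))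
    {v : HeightOneSpectrum (𝓞 (Fp L))} (w : UnitaryGroup.PlacesOver L v) (hw : IsCMField.complexConj L • w.1 ≠ w.1)
    (hJDi : (isUnit_placeForm _ (isUnit_reindex_diagonal_kronecker_JW L e dJ hdJ hdJ0 a) w.1).unit ∈ glInt 2 (w.1.adicCompletion L)) :
    ∀ y ∈ Representation.fixedPoints
            (show Representation ℂ (localPi L (IsCMField.complexConj L) 2 (Matrix.diagonal dJ) v) _ from
          (TwistedCoinv.rep (localCharOfCenter (Fp L) L (IsCMField.complexConj L) (JW (Fp L) L a)
            (JW_apply_ne_zero (Fp L) L a) χ.1 v) ((congrW L e dJ hdJ (lineW L (TW (Fp L) a)) (complexConj_lineW L (TW (Fp L) a)) (realDiagonal_lineW L (TW (Fp L) a))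
              (diagonal_lineW L (TW (Fp L) a) (JW_eq (Fp L) L a))
              (undoubledSplittings L e dJ hdJ hdJ0 (lineW L (TW (Fp L) a)) (complexConj_lineW L (TW (Fp L) a))
                (lineW_ne_zero L (TW (Fp L) a) (isUnit_det_TW (Fp L) a)) θ (borelPlaceMeasure L) (cmFinLocalFamily L e dJ hdJ hdJ0 (lineW L (TW (Fp L) a)) (complexConj_lineW L (TW (Fp L) a)) (lineW_ne_zero L (TW (Fp L) a) (isUnit_det_TW (Fp L) a)) θ hθs (borelPlaceMeasure L)))
              (isSymm_TW (Fp L) a) (JW_eq (Fp L) L a)).omegaLoc v)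
          (commute_omegaLoc_localCenter (Fp L) L (IsCMField.complexConj L) 2 e (Matrix.diagonal dJ) (JW (Fp L) L a)
            (complexConj_imagUnit L) (imagUnit_ne_zero L) (imagUnit_mul_self L) (realDiagonal_isSymm L dJ hdJ)
            (isSymm_TW (Fp L) a) (realDiagonal_map L dJ hdJ).symm (JW_eq (Fp L) L a) (JW_apply_ne_zero (Fp L) L a) (congrW L e dJ hdJ (lineW L (TW (Fp L) a)) (complexConj_lineW L (TW (Fp L) a)) (realDiagonal_lineW L (TW (Fp L) a))
              (diagonal_lineW L (TW (Fp L) a) (JW_eq (Fp L) L a))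
              (undoubledSplittings L e dJ hdJ hdJ0 (lineW L (TW (Fp L) a)) (complexConj_lineW L (TW (Fp L) a))
                (lineW_ne_zero L (TW (Fp L) a) (isUnit_det_TW (Fp L) a)) θ (borelPlaceMeasure L) (cmFinLocalFamily L e dJ hdJ hdJ0 (lineW L (TW (Fp L) a)) (complexConj_lineW L (TW (Fp L) a)) (lineW_ne_zero L (TW (Fp L) a) (isUnit_det_TW (Fp L) a)) θ hθs (borelPlaceMeasure L)))
              (isSymm_TW (Fp L) a) (JW_eq (Fp L) L a)) v)).comp
            (localLineInl L (IsCMField.complexConj L) 2 e (Matrix.diagonal dJ) (JW (Fp L) L a) v))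
            (localInt L (IsCMField.complexConj L) 2 (Matrix.diagonal dJ) v),
          heckeOperator
            (show Representation ℂ (localPi L (IsCMField.complexConj L) 2 (Matrix.diagonal dJ) v) _ from
          (TwistedCoinv.rep (localCharOfCenter (Fp L) L (IsCMField.complexConj L) (JW (Fp L) L a)
            (JW_apply_ne_zero (Fp L) L a) χ.1 v) ((congrW L e dJ hdJ (lineW L (TW (Fp L) a)) (complexConj_lineW L (TW (Fp L) a)) (realDiagonal_lineW L (TW (Fp L) a))
              (diagonal_lineW L (TW (Fp L) a) (JW_eq (Fp L) L a))
              (undoubledSplittings L e dJ hdJ hdJ0 (lineW L (TW (Fp L) a)) (complexConj_lineW L (TW (Fp L) a))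
                (lineW_ne_zero L (TW (Fp L) a) (isUnit_det_TW (Fp L) a)) θ (borelPlaceMeasure L) (cmFinLocalFamily L e dJ hdJ hdJ0 (lineW L (TW (Fp L) a)) (complexConj_lineW L (TW (Fp L) a)) (lineW_ne_zero L (TW (Fp L) a) (isUnit_det_TW (Fp L) a)) θ hθs (borelPlaceMeasure L)))
              (isSymm_TW (Fp L) a) (JW_eq (Fp L) L a)).omegaLoc v)
          (commute_omegaLoc_localCenter (Fp L) L (IsCMField.complexConj L) 2 e (Matrix.diagonal dJ) (JW (Fp L) L a)
            (complexConj_imagUnit L) (imagUnit_ne_zero L) (imagUnit_mul_self L) (realDiagonal_isSymm L dJ hdJ)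
            (isSymm_TW (Fp L) a) (realDiagonal_map L dJ hdJ).symm (JW_eq (Fp L) L a) (JW_apply_ne_zero (Fp L) L a) (congrW L e dJ hdJ (lineW L (TW (Fp L) a)) (complexConj_lineW L (TW (Fp L) a)) (realDiagonal_lineW L (TW (Fp L) a))
              (diagonal_lineW L (TW (Fp L) a) (JW_eq (Fp L) L a))
              (undoubledSplittings L e dJ hdJ hdJ0 (lineW L (TW (Fp L) a)) (complexConj_lineW L (TW (Fp L) a))
                (lineW_ne_zero L (TW (Fp L) a) (isUnit_det_TW (Fp L) a)) θ (borelPlaceMeasure L) (cmFinLocalFamily L e dJ hdJ hdJ0 (lineW L (TW (Fp L) a)) (complexConj_lineW L (TW (Fp L) a)) (lineW_ne_zero L (TW (Fp L) a) (isUnit_det_TW (Fp L) a)) θ hθs (borelPlaceMeasure L)))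
              (isSymm_TW (Fp L) a) (JW_eq (Fp L) L a)) v)).comp
            (localLineInl L (IsCMField.complexConj L) 2 e (Matrix.diagonal dJ) (JW (Fp L) L a) v))
            (localInt L (IsCMField.complexConj L) 2 (Matrix.diagonal dJ) v)
            ((localPiSplitEquiv (IsCMField.complexConj L) (Matrix.diagonal dJ) (IsCMField.complexConj_ne_one L) (conjTranspose_realDiagonal L dJ hdJ) w hw (isUnit_placeForm (Matrix.diagonal dJ) (isUnit_realDiagonal L dJ hdJ0) w.1)).symm
              (heckeDiag 2 (Units.mk0 ((HeckeCharacter.uniformizer L w.1 : (w.1.adicCompletion L)ˣ) : w.1.adicCompletion L) (Units.ne_zero _)) 1)) y =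
    (((Real.sqrt (GaloisRepresentations.IsNonarchimedeanLocalField.residueFieldCard (w.1.adicCompletion L))) : ℂ) *
      ((((θ.localComponent w.1) (Units.mk0 ((HeckeCharacter.uniformizer L w.1 : (w.1.adicCompletion L)ˣ) : w.1.adicCompletion L) (Units.ne_zero _)) : ℂˣ) : ℂ) +
        ((((HeckeCharacter.checkOfChi (complexConj_mul_complexConj' L) χ).localComponent w.1) (Units.mk0 ((HeckeCharacter.uniformizer L w.1 : (w.1.adicCompletion L)ˣ) : w.1.adicCompletion L) (Units.ne_zero _)) : ℂˣ) : ℂ) *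
          ((((θ.localComponent w.1) (Units.mk0 ((HeckeCharacter.uniformizer L w.1 : (w.1.adicCompletion L)ˣ) : w.1.adicCompletion L) (Units.ne_zero _)) : ℂˣ) : ℂ))⁻¹)) • y := fun _ hy =>
  (splitPlace_heckeOperator_localInt_apply_localSplittingCM_comp_localLineInl_enum L (IsCMField.complexConj_ne_one L) e
    (Matrix.diagonal dJ)
    (JW ↥(maximalRealSubfield L) L a) (JW_apply_ne_zero ↥(maximalRealSubfield L) L a) _ _ _ _
    (gram_realDiagonal_TW L e dJ hdJ a) _ (conjTranspose_realDiagonal L dJ hdJ)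
    (conjTranspose_reindex_diagonal_kronecker_JW L e dJ hdJ a) v w hw
    (isUnit_placeForm (Matrix.diagonal dJ) (isUnit_realDiagonal L dJ hdJ0) w.1)
    (isUnit_placeForm _ (isUnit_reindex_diagonal_kronecker_JW L e dJ hdJ hdJ0 a) w.1) hJDi θ hθs hθu _
    (GRConstruction.congrW_undoubledSplittings_cmFinLocalFamily_s L e dJ hdJ hdJ0
      (lineW L (TW ↥(maximalRealSubfield L) a)) (complexConj_lineW L (TW ↥(maximalRealSubfield L) a))
      (lineW_ne_zero L (TW ↥(maximalRealSubfield L) a) (isUnit_det_TW ↥(maximalRealSubfield L) a))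
      (realDiagonal_lineW L (TW ↥(maximalRealSubfield L) a))
      (diagonal_lineW L (TW ↥(maximalRealSubfield L) a) (JW_eq ↥(maximalRealSubfield L) L a))
      (isSymm_TW ↥(maximalRealSubfield L) a) (isUnit_det_TW ↥(maximalRealSubfield L) a)
      (JW_eq ↥(maximalRealSubfield L) L a) θ hθs v)
    (localCharOfCenter ↥(maximalRealSubfield L) L (IsCMField.complexConj L) (JW ↥(maximalRealSubfield L) L a)
      (JW_apply_ne_zero ↥(maximalRealSubfield L) L a) χ.1 v)
    (norm_localCharOfCenter ↥(maximalRealSubfield L) L (IsCMField.complexConj L) _ _ (norm_chi_eq_one_cm L χ) _)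
    (continuous_coe_localCharOfCenter ↥(maximalRealSubfield L) L (IsCMField.complexConj L) _ _ χ.2.1 _)
    ((HeckeCharacter.checkOfChi (complexConj_mul_complexConj' L) χ).localComponent w.1)
    (CheckOfChi.forall_localComponent_checkOfChi_det (complexConj_mul_complexConj' L)
      (JW_apply_ne_zero ↥(maximalRealSubfield L) L a) χ w hw)
    (isUniformizingElement_heckeCharacterUniformizer L w.1) hy).1

set_option maxHeartbeats 1600000 in -- measured 2026-09-04 (K2Liu-p01 g3): 1 200 000 FAILS, 1 600 000 passes; ★ twin `cm_hloc_two` 1.27 M by import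
/-- **Junction at an arbitrary enumeration `e`, `T₂`**: the same at `i = 2` (eigenvalue `χ̌_w(ϖ_w)`).
[cite: Liu2021, App. D proof of Lemma D.1, first paragraph (l. 5241, p. 126)] [cite: GelbartRogawski1991, §3.2 p. 457] -/
theorem cm_hloc_two_enum (L : Type) [Field L] [NumberField L] [IsCMField L]
    (θ : HeckeCharacter L) (hθu : θ.IsUnitary) (hθs : IsSplittingChar L 1 θ)
    (dJ : Fin 2 → L) (hdJ : ∀ i, IsCMField.complexConj L (dJ i) = dJ i) (hdJ0 : ∀ i, dJ i ≠ 0)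
    (e : Fin 2 × Fin 1 ≃ Fin 2) (a : (↥(maximalRealSubfield L))ˣ)
    (χ : Chi ↥(maximalRealSubfield L) L (IsCMField.complexConj L))
    {v : HeightOneSpectrum (𝓞 (Fp L))} (w : UnitaryGroup.PlacesOver L v) (hw : IsCMField.complexConj L • w.1 ≠ w.1)
    (hJDi : (isUnit_placeForm _ (isUnit_reindex_diagonal_kronecker_JW L e dJ hdJ hdJ0 a) w.1).unit ∈ glInt 2 (w.1.adicCompletion L)) :
    ∀ y ∈ Representation.fixedPoints
            (show Representation ℂ (localPi L (IsCMField.complexConj L) 2 (Matrix.diagonal dJ) v) _ from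
          (TwistedCoinv.rep (localCharOfCenter (Fp L) L (IsCMField.complexConj L) (JW (Fp L) L a)
            (JW_apply_ne_zero (Fp L) L a) χ.1 v) ((congrW L e dJ hdJ (lineW L (TW (Fp L) a)) (complexConj_lineW L (TW (Fp L) a)) (realDiagonal_lineW L (TW (Fp L) a))
              (diagonal_lineW L (TW (Fp L) a) (JW_eq (Fp L) L a))
              (undoubledSplittings L e dJ hdJ hdJ0 (lineW L (TW (Fp L) a)) (complexConj_lineW L (TW (Fp L) a))
                (lineW_ne_zero L (TW (Fp L) a) (isUnit_det_TW (Fp L) a)) θ (borelPlaceMeasure L) (cmFinLocalFamily L e dJ hdJ hdJ0 (lineW L (TW (Fp L) a)) (complexConj_lineW L (TW (Fp L) a)) (lineW_ne_zero L (TW (Fp L) a) (isUnit_det_TW (Fp L) a)) θ hθs (borelPlaceMeasure L)))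
              (isSymm_TW (Fp L) a) (JW_eq (Fp L) L a)).omegaLoc v)
          (commute_omegaLoc_localCenter (Fp L) L (IsCMField.complexConj L) 2 e (Matrix.diagonal dJ) (JW (Fp L) L a)
            (complexConj_imagUnit L) (imagUnit_ne_zero L) (imagUnit_mul_self L) (realDiagonal_isSymm L dJ hdJ)
            (isSymm_TW (Fp L) a) (realDiagonal_map L dJ hdJ).symm (JW_eq (Fp L) L a) (JW_apply_ne_zero (Fp L) L a) (congrW L e dJ hdJ (lineW L (TW (Fp L) a)) (complexConj_lineW L (TW (Fp L) a)) (realDiagonal_lineW L (TW (Fp L) a))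
              (diagonal_lineW L (TW (Fp L) a) (JW_eq (Fp L) L a))
              (undoubledSplittings L e dJ hdJ hdJ0 (lineW L (TW (Fp L) a)) (complexConj_lineW L (TW (Fp L) a))
                (lineW_ne_zero L (TW (Fp L) a) (isUnit_det_TW (Fp L) a)) θ (borelPlaceMeasure L) (cmFinLocalFamily L e dJ hdJ hdJ0 (lineW L (TW (Fp L) a)) (complexConj_lineW L (TW (Fp L) a)) (lineW_ne_zero L (TW (Fp L) a) (isUnit_det_TW (Fp L) a)) θ hθs (borelPlaceMeasure L)))
              (isSymm_TW (Fp L) a) (JW_eq (Fp L) L a)) v)).comp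
            (localLineInl L (IsCMField.complexConj L) 2 e (Matrix.diagonal dJ) (JW (Fp L) L a) v))
            (localInt L (IsCMField.complexConj L) 2 (Matrix.diagonal dJ) v),
          heckeOperator
            (show Representation ℂ (localPi L (IsCMField.complexConj L) 2 (Matrix.diagonal dJ) v) _ from
          (TwistedCoinv.rep (localCharOfCenter (Fp L) L (IsCMField.complexConj L) (JW (Fp L) L a)
            (JW_apply_ne_zero (Fp L) L a) χ.1 v) ((congrW L e dJ hdJ (lineW L (TW (Fp L) a)) (complexConj_lineW L (TW (Fp L) a)) (realDiagonal_lineW L (TW (Fp L) a))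
              (diagonal_lineW L (TW (Fp L) a) (JW_eq (Fp L) L a))
              (undoubledSplittings L e dJ hdJ hdJ0 (lineW L (TW (Fp L) a)) (complexConj_lineW L (TW (Fp L) a))
                (lineW_ne_zero L (TW (Fp L) a) (isUnit_det_TW (Fp L) a)) θ (borelPlaceMeasure L) (cmFinLocalFamily L e dJ hdJ hdJ0 (lineW L (TW (Fp L) a)) (complexConj_lineW L (TW (Fp L) a)) (lineW_ne_zero L (TW (Fp L) a) (isUnit_det_TW (Fp L) a)) θ hθs (borelPlaceMeasure L)))
              (isSymm_TW (Fp L) a) (JW_eq (Fp L) L a)).omegaLoc v)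
          (commute_omegaLoc_localCenter (Fp L) L (IsCMField.complexConj L) 2 e (Matrix.diagonal dJ) (JW (Fp L) L a)
            (complexConj_imagUnit L) (imagUnit_ne_zero L) (imagUnit_mul_self L) (realDiagonal_isSymm L dJ hdJ)
            (isSymm_TW (Fp L) a) (realDiagonal_map L dJ hdJ).symm (JW_eq (Fp L) L a) (JW_apply_ne_zero (Fp L) L a) (congrW L e dJ hdJ (lineW L (TW (Fp L) a)) (complexConj_lineW L (TW (Fp L) a)) (realDiagonal_lineW L (TW (Fp L) a))
              (diagonal_lineW L (TW (Fp L) a) (JW_eq (Fp L) L a))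
              (undoubledSplittings L e dJ hdJ hdJ0 (lineW L (TW (Fp L) a)) (complexConj_lineW L (TW (Fp L) a))
                (lineW_ne_zero L (TW (Fp L) a) (isUnit_det_TW (Fp L) a)) θ (borelPlaceMeasure L) (cmFinLocalFamily L e dJ hdJ hdJ0 (lineW L (TW (Fp L) a)) (complexConj_lineW L (TW (Fp L) a)) (lineW_ne_zero L (TW (Fp L) a) (isUnit_det_TW (Fp L) a)) θ hθs (borelPlaceMeasure L)))
              (isSymm_TW (Fp L) a) (JW_eq (Fp L) L a)) v)).comp
            (localLineInl L (IsCMField.complexConj L) 2 e (Matrix.diagonal dJ) (JW (Fp L) L a) v))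
            (localInt L (IsCMField.complexConj L) 2 (Matrix.diagonal dJ) v)
            ((localPiSplitEquiv (IsCMField.complexConj L) (Matrix.diagonal dJ) (IsCMField.complexConj_ne_one L) (conjTranspose_realDiagonal L dJ hdJ) w hw (isUnit_placeForm (Matrix.diagonal dJ) (isUnit_realDiagonal L dJ hdJ0) w.1)).symm
              (heckeDiag 2 (Units.mk0 ((HeckeCharacter.uniformizer L w.1 : (w.1.adicCompletion L)ˣ) : w.1.adicCompletion L) (Units.ne_zero _)) 2)) y = ((((HeckeCharacter.checkOfChi (complexConj_mul_complexConj' L) χ).localComponent w.1) (Units.mk0 ((HeckeCharacter.uniformizer L w.1 : (w.1.adicCompletion L)ˣ) : w.1.adicCompletion L) (Units.ne_zero _)) : ℂˣ) : ℂ) • y := fun _ hy =>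
  (splitPlace_heckeOperator_localInt_apply_localSplittingCM_comp_localLineInl_enum L (IsCMField.complexConj_ne_one L) e
    (Matrix.diagonal dJ)
    (JW ↥(maximalRealSubfield L) L a) (JW_apply_ne_zero ↥(maximalRealSubfield L) L a) _ _ _ _
    (gram_realDiagonal_TW L e dJ hdJ a) _ (conjTranspose_realDiagonal L dJ hdJ)
    (conjTranspose_reindex_diagonal_kronecker_JW L e dJ hdJ a) v w hw
    (isUnit_placeForm (Matrix.diagonal dJ) (isUnit_realDiagonal L dJ hdJ0) w.1)
    (isUnit_placeForm _ (isUnit_reindex_diagonal_kronecker_JW L e dJ hdJ hdJ0 a) w.1) hJDi θ hθs hθu _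
    (GRConstruction.congrW_undoubledSplittings_cmFinLocalFamily_s L e dJ hdJ hdJ0
      (lineW L (TW ↥(maximalRealSubfield L) a)) (complexConj_lineW L (TW ↥(maximalRealSubfield L) a))
      (lineW_ne_zero L (TW ↥(maximalRealSubfield L) a) (isUnit_det_TW ↥(maximalRealSubfield L) a))
      (realDiagonal_lineW L (TW ↥(maximalRealSubfield L) a))
      (diagonal_lineW L (TW ↥(maximalRealSubfield L) a) (JW_eq ↥(maximalRealSubfield L) L a))
      (isSymm_TW ↥(maximalRealSubfield L) a) (isUnit_det_TW ↥(maximalRealSubfield L) a)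
      (JW_eq ↥(maximalRealSubfield L) L a) θ hθs v)
    (localCharOfCenter ↥(maximalRealSubfield L) L (IsCMField.complexConj L) (JW ↥(maximalRealSubfield L) L a)
      (JW_apply_ne_zero ↥(maximalRealSubfield L) L a) χ.1 v)
    (norm_localCharOfCenter ↥(maximalRealSubfield L) L (IsCMField.complexConj L) _ _ (norm_chi_eq_one_cm L χ) _)
    (continuous_coe_localCharOfCenter ↥(maximalRealSubfield L) L (IsCMField.complexConj L) _ _ χ.2.1 _)
    ((HeckeCharacter.checkOfChi (complexConj_mul_complexConj' L) χ).localComponent w.1)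
    (CheckOfChi.forall_localComponent_checkOfChi_det (complexConj_mul_complexConj' L)
      (JW_apply_ne_zero ↥(maximalRealSubfield L) L a) χ w hw)
    (isUniformizingElement_heckeCharacterUniformizer L w.1) hy).2

end Summit.HodgeConjecture.HodgeConjecture.Cruxes.HLiu418.K2LiuSplitPlaceHeckeJunctionEnum

end
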